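import Summits.AtomisticToContinuum.Crystallization.Theorems.FrustratedLawDichotomyZoneFloor
import Summits.AtomisticToContinuum.Crystallization.Theorems.FrustratedLawDichotomyCoherentFloorHaloComplete

/-!
# FrustratedLawDichotomy · crux `AperiodicFrustratedLawGap` (stmt-AtomisticToContinuum-27623) — «zoneFloor′»: THE Z-ROW FLOORS ON RADIALLY COMPLETE TEMPLATES
# (ZONE-TRANSPORT class Z; FINDING «TEMPLATE-COMPLETENESS (radial straddlers)» r1861 (A), KFILE amendment E §E1-H/Z; decomp-a2c hand-1 g55)

`…ZoneFloor` (p861229) carries `hin : ∀ x ∈ a, ‖x‖ + τ ≤ R_W ∧ ⟪x, n⟫ + τ ≤ s`; its RADIAL conjunct together with coherence on the half-window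
excludes every perturbed full host half-lattice (the shell `R_W − 0.02 < r < R_W` is occupied), so Z rows over radially cut templates finance nothing.
This file is the sibling with the radial conjunct DELETED (the plane conjunct stays — a host tube never crosses the level), on lens-5's radially
`hin`-free halo kit `…CoherentFloorHaloComplete` §1:
* (Z1′) `sum_floor_le_setIntegral_halo'` — `Σ_{x∈a∖0} vlo x ≤ ∫_W V_LJ`: a template atom off the window is outside the ball, `r > R_W ≥ 1`,
  `V_LJ ≤ 0`;
* ★ `zoneFloor₂'` (branch 2′: `Σ vlo − halfEnergyCol s − tailCol R_W ≤ 2·rootEnergy`), ★ `zoneFloor₁'` (branch 1′: `Σ vlo − (tailCol R_Z − Σ kw) ≤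
  2·rootEnergy + 2·out_G`; the refund claims `kw` are restricted to tubes INSIDE the ball, `‖x‖ + τ ≤ R_W` joins `hkw` — straddling tubes are
  never refunded), the `_of_isRootedHardCore` forms and ★ `floor_transport_of_zoneFloor₁'/₂'` (the `hfloor` lines, via (329)
  `floor_add_net_of_floor(_outflow)`).
Statements = `…ZoneFloor`'s with `hin` weakened to `∀ x ∈ a, ⟪x, n⟫ + τ ≤ s`, `1 ≤ R_W` also in branch 1′, and the extra conjunct in `hkw`; nothing else.
DEF-FREE; imports TREE `…ZoneFloor` + `…CoherentFloorHaloComplete`; 0 sorry.  All `[folklore]`; nothing here closes an item.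
-/

noncomputable section

namespace Summit.AtomisticToContinuum.Crystallization.Theorems.FrustratedLawDichotomyZoneFloorComplete

open MeasureTheory Metric Set Filter RealInnerProductSpace
open scoped BigOperators Topology ENNReal
open Literature.MathematicalPhysics.StatisticalMechanics (lennardJones rootEnergy rootEnergy_def)
open Literature.Probability.Process (IsRootedHardCore count_restrict_singleton_ne_zero_iff)
open Literature.Probability.Process.LocalConfig (finite_inter_of_separated)
open Summit.AtomisticToContinuum.Crystallization.Theorems.ChargedEnergyGapNegative (E3)
open Summit.AtomisticToContinuum.Crystallization.Theorems.FrustratedLawDichotomySignedLedger (net)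
open Summit.AtomisticToContinuum.Crystallization.Theorems.FrustratedLawDichotomyCoherentWindow
open Summit.AtomisticToContinuum.Crystallization.Theorems.FrustratedLawDichotomyCoherentOn
open Summit.AtomisticToContinuum.Crystallization.Theorems.FrustratedLawDichotomyTransportPriceTail (integrable_lennardJones_of_isRootedHardCore)
open Summit.AtomisticToContinuum.Crystallization.Theorems.FrustratedLawDichotomyCoherentFloor (tailCol setLIntegral_enorm_lennardJones_compl_le
  abs_setIntegral_compl_lennardJones_le)
open Summit.AtomisticToContinuum.Crystallization.Theorems.FrustratedLawDichotomyCoherentFloorHalo (haloWindow halfEnergyCol measurableSet_halfSpace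
  measurableSet_haloWindow closedBall_subset_haloWindow setIntegral_ball_sdiff_lennardJones_ge)
open Summit.AtomisticToContinuum.Crystallization.Theorems.FrustratedLawDichotomyCoherentFloorHaloComplete (setIntegral_eq_sum_filter_of_coherentOn
  sum_lennardJones_atomOf_le_setIntegral_halo)
open Summit.AtomisticToContinuum.Crystallization.Theorems.FrustratedLawDichotomyPullKernel (zoneWeight zonePull pullKernel_of_mem toReal_zoneWeight
  zoneWeight_le exists_outflow_bound_zonePull floor_add_net_of_floor floor_add_net_of_floor_outflow)
open Summit.AtomisticToContinuum.Crystallization.Theorems.FrustratedLawDichotomyZoneFloor (norm_mem_tube)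

variable {S : Set E3} {τ : ℝ} {a : Finset E3}

/-! ## §1. (Z1′) The window term on a radially complete template -/

/-- ★ **(Z1′) WINDOW FLOOR, NO TAYLOR, NO RADIAL `hin`.**  On the halo window `W = B̄(0,R_W) ∩ {⟪z,n⟫ ≤ s}` (`R_W ≥ 1`) coherent with `a ∋ 0`
whose tubes lie BELOW THE PLANE (radially anything goes), per-site tube floors give `Σ_{x ∈ a∖0} vlo x ≤ ∫_W V_LJ d(count⌊S)`: a template atom off
the window is outside the ball, `r > R_W ≥ 1`, `V_LJ ≤ 0` (lens-5 `sum_lennardJones_atomOf_le_setIntegral_halo`). [folklore] -/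
theorem sum_floor_le_setIntegral_halo' {Rw s : ℝ} {n : E3} (vlo : E3 → ℝ) (hn : ‖n‖ = 1)
    (hS : ∀ p ∈ S, ∀ p' ∈ S, p ≠ p' → (7 : ℝ) / 10 ≤ dist p p') (h0S : (0 : E3) ∈ S) (hτ0 : 0 ≤ τ) (hτ : 2 * τ < 7 / 10) (hRw : 1 ≤ Rw)
    (hcoh : (Measure.count.restrict S : Measure E3) ∈ coherentOn a τ (haloWindow n s Rw)) (h0a : (0 : E3) ∈ a)
    (ha : ∀ x ∈ a, ∀ x' ∈ a, x ≠ x' → 2 * τ < dist x x') (hin : ∀ x ∈ a, ⟪x, n⟫ + τ ≤ s)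
    (hvlo : ∀ x ∈ a.erase 0, ∀ r : ℝ, ‖x‖ - τ ≤ r → r ≤ ‖x‖ + τ → vlo x ≤ lennardJones r) :
    ∑ x ∈ a.erase 0, vlo x ≤ ∫ z in haloWindow n s Rw, lennardJones ‖z‖ ∂(Measure.count.restrict S : Measure E3) := by
  classical
  have hW := measurableSet_haloWindow n s Rw
  have hne : ∀ z ∈ a, (closedBall z τ ∩ S).Nonempty := fun z hz => nonempty_of_mem_coherentOn hW hcoh hz
  have hsum := sum_lennardJones_atomOf_le_setIntegral_halo hn hS hτ hcoh ha hRw hin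
  rw [← Finset.sum_erase_add a _ h0a, atomOf_zero hS hτ h0S hτ0, norm_zero] at hsum
  have hV0 : lennardJones 0 = 0 := by unfold lennardJones; simp
  rw [hV0, add_zero] at hsum
  refine le_trans (Finset.sum_le_sum fun x hx => ?_) hsum
  have htube := norm_mem_tube (atomOf_mem (hne x (Finset.mem_of_mem_erase hx))).1
  exact hvlo x hx _ htube.1 htube.2

/-! ## §2. ★ BRANCH 2′ -/

/-- ★ **`zoneFloor₂'` — THE NASH-FREE HALO FLOOR on a radially complete template**: as `…ZoneFloor.zoneFloor₂` with `hin` weakened to its PLANE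
conjunct `∀ x ∈ a, ⟪x, n⟫ + τ ≤ s`.  Same three columns. [folklore] -/
theorem zoneFloor₂' {Rw s : ℝ} {n : E3} (vlo : E3 → ℝ) (hn : ‖n‖ = 1) (hs : 1 ≤ s)
    (hS : ∀ p ∈ S, ∀ p' ∈ S, p ≠ p' → (7 : ℝ) / 10 ≤ dist p p') (h0S : (0 : E3) ∈ S) (hτ0 : 0 ≤ τ) (hτ : 2 * τ < 7 / 10) (hRw : 1 ≤ Rw)
    (hcoh : (Measure.count.restrict S : Measure E3) ∈ coherentOn a τ (haloWindow n s Rw)) (h0a : (0 : E3) ∈ a)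
    (ha : ∀ x ∈ a, ∀ x' ∈ a, x ≠ x' → 2 * τ < dist x x') (hin : ∀ x ∈ a, ⟪x, n⟫ + τ ≤ s)
    (hvlo : ∀ x ∈ a.erase 0, ∀ r : ℝ, ‖x‖ - τ ≤ r → r ≤ ‖x‖ + τ → vlo x ≤ lennardJones r) :
    ∑ x ∈ a.erase 0, vlo x - halfEnergyCol s - tailCol Rw ≤ 2 * rootEnergy lennardJones (Measure.count.restrict S : Measure E3) := by
  have h7 : (0 : ℝ) < 7 / 10 := by norm_num
  have hwin := sum_floor_le_setIntegral_halo' vlo hn hS h0S hτ0 hτ hRw hcoh h0a ha hin hvlo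
  have hint := integrable_lennardJones_of_isRootedHardCore h7 ⟨S, h0S, hS, rfl⟩
  have htail := (abs_le.mp (abs_setIntegral_compl_lennardJones_le hS hRw)).1
  have hhalf := setIntegral_ball_sdiff_lennardJones_ge (Rc := Rw) hn hs hS
  have hball : ∫ z in closedBall (0 : E3) Rw, lennardJones ‖z‖ ∂(Measure.count.restrict S : Measure E3) =
      (∫ z in haloWindow n s Rw, lennardJones ‖z‖ ∂(Measure.count.restrict S : Measure E3)) +
        ∫ z in closedBall (0 : E3) Rw \ {z : E3 | ⟪z, n⟫ ≤ s}, lennardJones ‖z‖ ∂(Measure.count.restrict S : Measure E3) := by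
    rw [haloWindow]
    exact (integral_inter_add_sdiff (measurableSet_halfSpace n s) hint.integrableOn).symm
  have hE : 2 * rootEnergy lennardJones (Measure.count.restrict S : Measure E3) =
      (∫ z in closedBall (0 : E3) Rw, lennardJones ‖z‖ ∂(Measure.count.restrict S : Measure E3)) +
        ∫ z in (closedBall (0 : E3) Rw)ᶜ, lennardJones ‖z‖ ∂(Measure.count.restrict S : Measure E3) := by
    rw [rootEnergy_def, integral_add_compl measurableSet_closedBall hint]
    ring
  rw [hE, hball]
  linarith

/-! ## §3. ★ BRANCH 1′ -/

/-- ★ **`zoneFloor₁'` — THE PULL FLOOR on a radially complete template**: as `…ZoneFloor.zoneFloor₁` with `hin` weakened to its PLANE conjunct and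
`1 ≤ R_W`; the refund claims `kw` are now restricted to tubes INSIDE the ball (`‖x‖ + τ ≤ R_W`, part of `hkw`): a straddling template atom off the
window has `V_LJ ≤ 0` and is booked non-positively twice (window, tail), never refunded. [folklore] -/
theorem zoneFloor₁' {Rw Rz s : ℝ} {n : E3} (vlo kw : E3 → ℝ) (Hm : Measure E3 → E3 → Prop) (hn : ‖n‖ = 1)
    (hS : ∀ p ∈ S, ∀ p' ∈ S, p ≠ p' → (7 : ℝ) / 10 ≤ dist p p') (h0S : (0 : E3) ∈ S) (hτ0 : 0 ≤ τ) (hτ : 2 * τ < 7 / 10) (hRz : 1 ≤ Rz)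
    (hRw : 1 ≤ Rw) (hcoh : (Measure.count.restrict S : Measure E3) ∈ coherentOn a τ (haloWindow n s Rw)) (h0a : (0 : E3) ∈ a)
    (ha : ∀ x ∈ a, ∀ x' ∈ a, x ≠ x' → 2 * τ < dist x x') (hin : ∀ x ∈ a, ⟪x, n⟫ + τ ≤ s)
    (hvlo : ∀ x ∈ a.erase 0, ∀ r : ℝ, ‖x‖ - τ ≤ r → r ≤ ‖x‖ + τ → vlo x ≤ lennardJones r)
    (hkw : ∀ x ∈ a.erase 0, 0 < kw x →
      Rz < ‖x‖ - τ ∧ ‖x‖ + τ ≤ Rw ∧ ∀ r : ℝ, ‖x‖ - τ ≤ r → r ≤ ‖x‖ + τ → kw x ≤ |lennardJones r|)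
    (h0 : Hm (Measure.count.restrict S : Measure E3) 0)
    (hD : ∀ q ∈ S, ‖q‖ ≤ Rz → q ∉ haloWindow n s Rw → ¬ Hm (Measure.count.restrict S : Measure E3) q) :
    ∑ x ∈ a.erase 0, vlo x - (tailCol Rz - ∑ x ∈ a.erase 0, kw x) ≤
      2 * rootEnergy lennardJones (Measure.count.restrict S : Measure E3) +
        2 * (∫⁻ y, zonePull Hm Rz (Measure.count.restrict S : Measure E3) y ∂(Measure.count.restrict S : Measure E3)).toReal := by
  classical
  have h7 : (0 : ℝ) < 7 / 10 := by norm_num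
  set μ : Measure E3 := Measure.count.restrict S with hμ
  set W : Set E3 := haloWindow n s Rw with hWdef
  set B : Set E3 := closedBall (0 : E3) Rz with hBdef
  have hW : MeasurableSet W := measurableSet_haloWindow n s Rw
  have hB : MeasurableSet B := measurableSet_closedBall
  have hne : ∀ z ∈ a, (closedBall z τ ∩ S).Nonempty := fun z hz => nonempty_of_mem_coherentOn hW hcoh hz
  have hint : Integrable (fun z : E3 => lennardJones ‖z‖) μ := integrable_lennardJones_of_isRootedHardCore h7 ⟨S, h0S, hS, rfl⟩
  -- (Z1′) the window
  have hwin : ∑ x ∈ a.erase 0, vlo x ≤ ∫ z in W, lennardJones ‖z‖ ∂μ :=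
    sum_floor_le_setIntegral_halo' vlo hn hS h0S hτ0 hτ hRw hcoh h0a ha hin hvlo
  -- the energy split `E3 = W ∪ (Wᶜ ∩ B) ∪ (Wᶜ ∖ B)`
  have hE : 2 * rootEnergy lennardJones μ = (∫ z in W, lennardJones ‖z‖ ∂μ) + ∫ z in Wᶜ, lennardJones ‖z‖ ∂μ := by
    rw [rootEnergy_def, integral_add_compl hW hint]
    ring
  have hE2 : ∫ z in Wᶜ, lennardJones ‖z‖ ∂μ = (∫ z in Wᶜ ∩ B, lennardJones ‖z‖ ∂μ) + ∫ z in Wᶜ \ B, lennardJones ‖z‖ ∂μ :=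
    (integral_inter_add_sdiff hB hint.integrableOn).symm
  -- (Z2) the pulled atoms
  have hfin : ((Wᶜ ∩ B) ∩ S).Finite :=
    (finite_inter_of_separated h7 hS (isCompact_closedBall (0 : E3) Rz)).subset fun z hz => ⟨hz.1.2, hz.2⟩
  set F : Finset E3 := hfin.toFinset with hF
  have hmemF : ∀ z ∈ F, z ∈ S ∧ ‖z‖ ≤ Rz ∧ z ∉ W := fun z hz => by
    rw [hF, Finite.mem_toFinset] at hz
    exact ⟨hz.2, mem_closedBall_zero_iff.mp hz.1.2, hz.1.1⟩
  have hrestr : μ.restrict (Wᶜ ∩ B) = Measure.count.restrict (↑F : Set E3) := by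
    rw [hμ, Measure.restrict_restrict (hW.compl.inter hB), hF, Finite.coe_toFinset]
  have hmidE : ∫ z in Wᶜ ∩ B, lennardJones ‖z‖ ∂μ = ∑ z ∈ F, lennardJones ‖z‖ := by
    rw [hrestr, Literature.MathematicalPhysics.StatisticalMechanics.integral_count_restrict_coe_finset]
  have hpull : ∀ z ∈ F, zonePull Hm Rz μ z = zoneWeight z := fun z hz =>
    pullKernel_of_mem h0 (hmemF z hz).2.1 (hD z (hmemF z hz).1 (hmemF z hz).2.1 (hmemF z hz).2.2)
  have hmidG : ∑ z ∈ F, zoneWeight z ≤ ∫⁻ y, zonePull Hm Rz μ y ∂μ := by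
    calc ∑ z ∈ F, zoneWeight z = ∑ z ∈ F, zonePull Hm Rz μ z * Measure.count {z} := by
          refine Finset.sum_congr rfl fun z hz => ?_
          rw [hpull z hz, Measure.count_singleton, mul_one]
      _ = ∫⁻ y in Wᶜ ∩ B, zonePull Hm Rz μ y ∂μ := by rw [hrestr, lintegral_finset]
      _ ≤ ∫⁻ y, zonePull Hm Rz μ y ∂μ := setLIntegral_le_lintegral _ _
  obtain ⟨Bo, hBo, hGb⟩ := exists_outflow_bound_zonePull h7 Hm Rz
  have hfinG : ∫⁻ y, zonePull Hm Rz μ y ∂μ ≠ ∞ := ne_top_of_le_ne_top hBo (hGb μ ⟨S, h0S, hS, rfl⟩)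
  have hwne : ∀ z ∈ F, zoneWeight z ≠ ∞ := fun z _ => ne_top_of_le_ne_top ENNReal.ofReal_ne_top (zoneWeight_le z)
  have hmidG' : ∑ z ∈ F, max (-(lennardJones ‖z‖) / 2) 0 ≤ (∫⁻ y, zonePull Hm Rz μ y ∂μ).toReal := by
    have h := ENNReal.toReal_mono hfinG hmidG
    rw [ENNReal.toReal_sum hwne] at h
    simpa only [toReal_zoneWeight] using h
  have hmid : 0 ≤ (∑ z ∈ F, lennardJones ‖z‖) + 2 * ∑ z ∈ F, max (-(lennardJones ‖z‖) / 2) 0 := by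
    rw [Finset.mul_sum, ← Finset.sum_add_distrib]
    exact Finset.sum_nonneg fun z _ => by linarith [le_max_left (-(lennardJones ‖z‖) / 2) 0]
  -- (Z3′) the rest lies outside `B`: tail minus the refunds of the tubes INSIDE the window
  have hset : Wᶜ \ B = Bᶜ \ W := by
    ext z
    exact ⟨fun h => ⟨h.2, h.1⟩, fun h => ⟨h.2, h.1⟩⟩
  have htailAbs : ∫ z in Bᶜ, ‖lennardJones ‖z‖‖ ∂μ ≤ tailCol Rz := by
    have h0t : 0 ≤ tailCol Rz := by
      have : 0 ≤ Rz⁻¹ := inv_nonneg.2 (by linarith)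
      unfold tailCol; positivity
    rw [integral_norm_eq_lintegral_enorm hint.aestronglyMeasurable.restrict]
    calc (∫⁻ z in Bᶜ, ‖lennardJones ‖z‖‖ₑ ∂μ).toReal ≤ (ENNReal.ofReal (tailCol Rz)).toReal :=
          ENNReal.toReal_mono ENNReal.ofReal_ne_top (setLIntegral_enorm_lennardJones_compl_le hS hRz)
      _ = tailCol Rz := ENNReal.toReal_ofReal h0t
  have hsplitAbs : (∫ z in Bᶜ ∩ W, ‖lennardJones ‖z‖‖ ∂μ) + ∫ z in Bᶜ \ W, ‖lennardJones ‖z‖‖ ∂μ =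
      ∫ z in Bᶜ, ‖lennardJones ‖z‖‖ ∂μ :=
    integral_inter_add_sdiff hW hint.norm.integrableOn
  have hrefund : ∑ x ∈ a.erase 0, kw x ≤ ∫ z in Bᶜ ∩ W, ‖lennardJones ‖z‖‖ ∂μ := by
    have hind : ∫ z in Bᶜ ∩ W, ‖lennardJones ‖z‖‖ ∂μ =
        ∑ x ∈ a.filter (fun x => atomOf S τ x ∈ W), (Bᶜ).indicator (fun z => ‖lennardJones ‖z‖‖) (atomOf S τ x) := by
      rw [inter_comm, ← setIntegral_indicator hB.compl,
        setIntegral_eq_sum_filter_of_coherentOn hS hτ hW hcoh ha ((Bᶜ).indicator fun z => ‖lennardJones ‖z‖‖)]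
    rw [hind, Finset.sum_filter]
    have hnn : ∀ x ∈ a, 0 ≤ (if atomOf S τ x ∈ W then (Bᶜ).indicator (fun z => ‖lennardJones ‖z‖‖) (atomOf S τ x) else 0) :=
      fun x _ => by split_ifs; exacts [Set.indicator_nonneg (fun _ _ => norm_nonneg _) _, le_rfl]
    refine (Finset.sum_le_sum fun x hx => ?_).trans (Finset.sum_le_sum_of_subset_of_nonneg (Finset.erase_subset 0 a) fun x hx _ => hnn x hx)
    have hxa := Finset.mem_of_mem_erase hx
    by_cases hk : kw x ≤ 0
    · exact hk.trans (hnn x hxa)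
    · obtain ⟨hfar, hball, hbd⟩ := hkw x hx (not_le.mp hk)
      have hm := atomOf_mem (hne x hxa)
      have htube := norm_mem_tube hm.1
      have hinW : atomOf S τ x ∈ W := closedBall_subset_haloWindow hn hball (hin x hxa) hm.1
      have hout : atomOf S τ x ∈ Bᶜ := by
        rw [mem_compl_iff, hBdef, mem_closedBall_zero_iff, not_le]
        linarith [htube.1]
      rw [if_pos hinW, indicator_of_mem hout, Real.norm_eq_abs]
      exact hbd _ htube.1 htube.2
  have hrest : -(tailCol Rz - ∑ x ∈ a.erase 0, kw x) ≤ ∫ z in Wᶜ \ B, lennardJones ‖z‖ ∂μ := by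
    rw [hset]
    have h1 : -(∫ z in Bᶜ \ W, ‖lennardJones ‖z‖‖ ∂μ) ≤ ∫ z in Bᶜ \ W, lennardJones ‖z‖ ∂μ := by
      have h := norm_integral_le_integral_norm (μ := μ.restrict (Bᶜ \ W)) (fun z : E3 => lennardJones ‖z‖)
      rw [Real.norm_eq_abs] at h
      linarith [neg_abs_le (∫ z in Bᶜ \ W, lennardJones ‖z‖ ∂μ)]
    linarith
  -- assembly
  rw [hE, hE2, hmidE]
  linarith

/-! ## §4. Abstract configurations and the transported row floors -/

/-- `zoneFloor₂'` for an abstract rooted `7/10`-hard-core `μ`. [folklore] -/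
theorem zoneFloor₂'_of_isRootedHardCore {μ : Measure E3} {Rw s : ℝ} {n : E3} (vlo : E3 → ℝ) (hn : ‖n‖ = 1) (hs : 1 ≤ s)
    (hμ : IsRootedHardCore (7 / 10) μ) (hτ0 : 0 ≤ τ) (hτ : 2 * τ < 7 / 10) (hRw : 1 ≤ Rw) (hcoh : μ ∈ coherentOn a τ (haloWindow n s Rw))
    (h0a : (0 : E3) ∈ a) (ha : ∀ x ∈ a, ∀ x' ∈ a, x ≠ x' → 2 * τ < dist x x') (hin : ∀ x ∈ a, ⟪x, n⟫ + τ ≤ s)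
    (hvlo : ∀ x ∈ a.erase 0, ∀ r : ℝ, ‖x‖ - τ ≤ r → r ≤ ‖x‖ + τ → vlo x ≤ lennardJones r) :
    ∑ x ∈ a.erase 0, vlo x - halfEnergyCol s - tailCol Rw ≤ 2 * rootEnergy lennardJones μ := by
  obtain ⟨S, h0S, hS, rfl⟩ := hμ
  exact zoneFloor₂' vlo hn hs hS h0S hτ0 hτ hRw hcoh h0a ha hin hvlo

/-- `zoneFloor₁'` for an abstract rooted `7/10`-hard-core `μ`, D-facing clause in the plane form (`R_Z ≤ R_W`). [folklore] -/
theorem zoneFloor₁'_of_isRootedHardCore {μ : Measure E3} {Rw Rz s : ℝ} {n : E3} (vlo kw : E3 → ℝ) (Hm : Measure E3 → E3 → Prop)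
    (hn : ‖n‖ = 1) (hμ : IsRootedHardCore (7 / 10) μ) (hτ0 : 0 ≤ τ) (hτ : 2 * τ < 7 / 10) (hRz : 1 ≤ Rz) (hzw : Rz ≤ Rw)
    (hcoh : μ ∈ coherentOn a τ (haloWindow n s Rw)) (h0a : (0 : E3) ∈ a) (ha : ∀ x ∈ a, ∀ x' ∈ a, x ≠ x' → 2 * τ < dist x x')
    (hin : ∀ x ∈ a, ⟪x, n⟫ + τ ≤ s)
    (hvlo : ∀ x ∈ a.erase 0, ∀ r : ℝ, ‖x‖ - τ ≤ r → r ≤ ‖x‖ + τ → vlo x ≤ lennardJones r)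
    (hkw : ∀ x ∈ a.erase 0, 0 < kw x →
      Rz < ‖x‖ - τ ∧ ‖x‖ + τ ≤ Rw ∧ ∀ r : ℝ, ‖x‖ - τ ≤ r → r ≤ ‖x‖ + τ → kw x ≤ |lennardJones r|)
    (h0 : Hm μ 0) (hD : ∀ q : E3, μ {q} ≠ 0 → ‖q‖ ≤ Rz → s < ⟪q, n⟫ → ¬ Hm μ q) :
    ∑ x ∈ a.erase 0, vlo x - (tailCol Rz - ∑ x ∈ a.erase 0, kw x) ≤ 2 * rootEnergy lennardJones μ + 2 * (∫⁻ y, zonePull Hm Rz μ y ∂μ).toReal := by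
  obtain ⟨S, h0S, hS, rfl⟩ := hμ
  refine zoneFloor₁' vlo kw Hm hn hS h0S hτ0 hτ hRz (hRz.trans hzw) hcoh h0a ha hin hvlo hkw h0 fun q hqS hqz hqW => hD q ?_ hqz ?_
  · exact (count_restrict_singleton_ne_zero_iff S q).mpr hqS
  · by_contra hle
    exact hqW ⟨mem_closedBall_zero_iff.mpr (hqz.trans hzw), not_lt.mp hle⟩

/-- ★ **THE TRANSPORTED Z-ROW FLOOR, branch 1′** (the `hfloor` line of a Z cell on a radially complete template). [folklore] -/
theorem floor_transport_of_zoneFloor₁' {μ : Measure E3} {Rw Rz s c m : ℝ} {n : E3} (vlo kw : E3 → ℝ) (Hm : Measure E3 → E3 → Prop)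
    (hshift : ∀ (ν : Measure E3) (y z : E3), Hm (ν.map fun x => x - y) z ↔ Hm ν (z + y))
    (hn : ‖n‖ = 1) (hμ : IsRootedHardCore (7 / 10) μ) (hτ0 : 0 ≤ τ) (hτ : 2 * τ < 7 / 10) (hRz : 1 ≤ Rz) (hzw : Rz ≤ Rw)
    (hcoh : μ ∈ coherentOn a τ (haloWindow n s Rw)) (h0a : (0 : E3) ∈ a) (ha : ∀ x ∈ a, ∀ x' ∈ a, x ≠ x' → 2 * τ < dist x x')
    (hin : ∀ x ∈ a, ⟪x, n⟫ + τ ≤ s)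
    (hvlo : ∀ x ∈ a.erase 0, ∀ r : ℝ, ‖x‖ - τ ≤ r → r ≤ ‖x‖ + τ → vlo x ≤ lennardJones r)
    (hkw : ∀ x ∈ a.erase 0, 0 < kw x →
      Rz < ‖x‖ - τ ∧ ‖x‖ + τ ≤ Rw ∧ ∀ r : ℝ, ‖x‖ - τ ≤ r → r ≤ ‖x‖ + τ → kw x ≤ |lennardJones r|)
    (h0 : Hm μ 0) (hD : ∀ q : E3, μ {q} ≠ 0 → ‖q‖ ≤ Rz → s < ⟪q, n⟫ → ¬ Hm μ q)
    (hlit : 2 * (c + m) ≤ ∑ x ∈ a.erase 0, vlo x - (tailCol Rz - ∑ x ∈ a.erase 0, kw x)) :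
    c + m ≤ rootEnergy lennardJones μ + net 0 (zonePull Hm Rz) μ := by
  have h := zoneFloor₁'_of_isRootedHardCore vlo kw Hm hn hμ hτ0 hτ hRz hzw hcoh h0a ha hin hvlo hkw h0 hD
  refine floor_add_net_of_floor_outflow hshift h0 ?_
  show c + m ≤ rootEnergy lennardJones μ + (∫⁻ y, zonePull Hm Rz μ y ∂μ).toReal
  linarith

/-- ★ **THE TRANSPORTED Z-ROW FLOOR, branch 2′** (radially complete template; the out-flow is not collected). [folklore] -/
theorem floor_transport_of_zoneFloor₂' {μ : Measure E3} {Rw R s c m : ℝ} {n : E3} (vlo : E3 → ℝ) (Hm : Measure E3 → E3 → Prop)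
    (hshift : ∀ (ν : Measure E3) (y z : E3), Hm (ν.map fun x => x - y) z ↔ Hm ν (z + y))
    (hn : ‖n‖ = 1) (hs : 1 ≤ s) (hμ : IsRootedHardCore (7 / 10) μ) (hτ0 : 0 ≤ τ) (hτ : 2 * τ < 7 / 10) (hRw : 1 ≤ Rw)
    (hcoh : μ ∈ coherentOn a τ (haloWindow n s Rw)) (h0a : (0 : E3) ∈ a) (ha : ∀ x ∈ a, ∀ x' ∈ a, x ≠ x' → 2 * τ < dist x x')
    (hin : ∀ x ∈ a, ⟪x, n⟫ + τ ≤ s)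
    (hvlo : ∀ x ∈ a.erase 0, ∀ r : ℝ, ‖x‖ - τ ≤ r → r ≤ ‖x‖ + τ → vlo x ≤ lennardJones r) (h0 : Hm μ 0)
    (hlit : 2 * (c + m) ≤ ∑ x ∈ a.erase 0, vlo x - halfEnergyCol s - tailCol Rw) :
    c + m ≤ rootEnergy lennardJones μ + net 0 (zonePull Hm R) μ := by
  have h := zoneFloor₂'_of_isRootedHardCore vlo hn hs hμ hτ0 hτ hRw hcoh h0a ha hin hvlo
  exact floor_add_net_of_floor hshift h0 (by linarith)

end Summit.AtomisticToContinuum.Crystallization.Theorems.FrustratedLawDichotomyZoneFloorComplete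

end
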